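import Summits.ResolutionOfSingularities.ResolutionOfSingularities.Theorems.HomologicalConductorSurfaceTerminationGenusChart
import Summits.ResolutionOfSingularities.ResolutionOfSingularities.Theorems.HomologicalConductorSurfaceTerminationGoodCover
import Literature.AlgebraicGeometry.Morphisms.UnitIsoOver
import Literature.AlgebraicGeometry.Morphisms.IsoOverOpen
import Literature.AlgebraicGeometry.Resolution.FundamentalLocus
import HarnessLib

/-!
# Crux `NoZenoR` (stmt-ResolutionOfSingularities-19943) — Lipman (1.2) 1) «rational singularities ASCEND to the
# normal points of a birational model», the COHOMOLOGICAL CORE over a PROJECTIVE model, fact-free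

Route `ResolutionOfSingularities/HomologicalConductor` (cell decomp-res, hand leafhand-res-homologicalconduct-12 g1).
OURS: AI-written, weaker than expert review; nothing here is a statement of the manuscript under review (Hironaka 2017).
SUPPORT level (`--supports stmt-19943`), counted 0.  Def-free, FACT-FREE (no named fact is consumed).

The chain's stage-rationality feed `NoZeno.SandwichCluster.hasRationalSingularity_of_isLocalization` consumes the
named fact `Lipman1969_1_2` in its part 1) form («if `w ∈ W` is a normal point of codimension two, then `𝒪_{W,w}` has a
rational singularity»).  Lipman's proof of 1) (Publ. IHÉS 36, p. 200 with footnote (1)) runs: replace `W` by a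
PROJECTIVE model `W*` through the point; take `h : Z → W*` with `H¹(Z, 𝒪_Z) = 0` (statements A), B)); then
`H²(W*, h_*𝒪_Z) = 0` by EGA III (4.2.2) and the exact sequence `H¹(Z, 𝒪_Z) → H⁰(W*, R¹h_*𝒪_Z) → H²(W*, h_*𝒪_Z)`
give `R¹h_*𝒪_Z = 0`, so that `V = Spec(𝒪_w) ×_{W*} Z` is a desingularization of `Spec 𝒪_w` with `H¹(V, 𝒪_V) = 0`.

This file proves that cohomological core in the tree's Čech vocabulary, WITHOUT the theorem on formal functions and
WITHOUT the named fact `GortzWedhorn2023_24_44_H2`: the `H²`-input is the PROVED projective case of Görtz–Wedhorn II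
Cor. 24.44 (`Morphisms/CechH2FibreDimOneProjective`, p613816) through the fact-free (S)-step
`Morphisms.length_cechH1_preimage_piece_le_of_isProjectiveOverRing` (`CechH1PreimageGluingProjective`), the passage to
the local ring is the chart lemma `SurfaceTermination.GenusDescent.exists_isResolution_length_cechH1_le_of_chart`
(`…SurfaceTerminationGenusChart`, EGA III (1.4.15) by flat base change of `Ȟ¹`).

* `hasRationalSingularity_of_chart_of_isProjectiveOverRing` — **the core**: `T` a Noetherian local domain of dimension
  `≤ 2`; `f : Z → Spec T` proper with `H¹(Z, 𝒪_Z) = 0` (`HasTrivialCechH1 f`); `g_B : B → Spec T` proper birational,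
  `B` integral, PROJECTIVE over `T`; `σ_B : Z → B` over `T`; a family of affine opens `(W_a)` covering `B` with a
  distinguished member `W_{a₀}` whose MIXED pieces `σ_B⁻¹(W_{a₀} ∩ W_b)` (`b ≠ a₀`) are `Ȟ¹`-acyclic; a resolution
  `σ : σ_B⁻¹W_{a₀} → Spec N` of the chart ring compatible with the structure maps; then EVERY localisation `T'` of `N`
  has a rational singularity (a resolution with `Ȟ¹ = 0` on every finite affine cover).
* `cechZ1_le_cechB1_of_iSup_eq_preimage_of_isIso` — the mixed-piece acyclicity holds over every affine open over which
  `σ_B` is an isomorphism (the preimage is affine; Görtz–Wedhorn II Lemma 22.1).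
* `hasRationalSingularity_of_isIso_off_point_of_isProjectiveOverRing` — **the packaged form at a closed point `w`**:
  if `σ_B` is an isomorphism over an open `Ω` containing `W₀ ∖ {w}` for an affine open `W₀ ∋ w` (i.e. `w` is at worst an
  ISOLATED point of the fundamental locus of `σ_B⁻¹` inside `W₀`), the «good cover» `{W₀} ∪ {W_b ⊆ B ∖ {w}}`
  (`exists_affineCover_eq_and_disjoint`) has acyclic mixed pieces, and the core applies to a resolution
  `σ : σ_B⁻¹W₀ → Spec N` of the chart.

What is NOT here (the remaining assembly of (1.2) 1) for the chain, sizes in the hand's report): the projective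
compactification of the affine model `Spec B → Spec R` (tree: `ChowLemmaRing.exists_immersion_projOver` + scheme-theoretic
image), statement B) (`Lipman1969_1_2_B`, named fact) to produce `Z`, the isolation of `w` in the fundamental locus
(tree: `Resolution.FundamentalLocus`), and the identification of `𝒪_{W*,w}` with the consumer's `B_𝔮`.
No crux, kill test or summit statement is proved; resolution of singularities in positive characteristic is NOT proved.

## References
* J. Lipman, *Rational singularities …*, Publ. Math. IHÉS 36 (1969): Prop. (1.2) 1) and its proof, p. 200, footnote (1).
  [Lipman1969]
* U. Görtz, T. Wedhorn, *Algebraic Geometry II* (2023): Cor. 21.82, Lemma 22.1, Cor. 24.44. [GortzWedhorn2023]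
* A. Grothendieck, EGA III₁ (1961): (1.4.15), (4.2.2). [EGAIII1]
-/

noncomputable section

-- single-problem summit: the doubled namespace component `ResolutionOfSingularities` is forced
set_option linter.dupNamespace false

namespace Summit.ResolutionOfSingularities.ResolutionOfSingularities.Theorems.NoZeno.RationalAscent

open CategoryTheory CategoryTheory.Limits AlgebraicGeometry TopologicalSpace IsLocalRing
open Literature.AlgebraicGeometry.Resolution Literature.AlgebraicGeometry.Morphisms
open Summit.ResolutionOfSingularities.ResolutionOfSingularities.Theorems.SurfaceTermination.GenusDescent

/-! ## The cohomological core over a projective model -/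

/-- **Lipman (1.2) 1), cohomological core over a PROJECTIVE model (fact-free).**  `T` a Noetherian local domain of
Krull dimension `≤ 2`; `f : Z → Spec T` proper with `H¹(Z, 𝒪_Z) = 0`; `g_B : B → Spec T` proper birational with `B`
integral and projective over `T`; `σ_B : Z → B` with `σ_B ≫ g_B = f`; `(W_a)_a` affine opens covering `B`, `a₀` an
index such that for `b ≠ a₀` every family of opens of `Z` with union `σ_B⁻¹(W_{a₀} ∩ W_b)` has all its Čech
`1`-cocycles coboundaries; `σ : σ_B⁻¹W_{a₀} → Spec N` a resolution with `(σ_B⁻¹W_{a₀}) ↪ Z → Spec T` equal to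
`σ ≫ Spec(T → N)`; `T'` a localisation of `N`.  Then `T'` has a rational singularity.  Proof: on a finite affine
refinement `𝒰` of `σ_B⁻¹𝒲`, `ℓ_T Ȟ¹((U_i ∩ σ_B⁻¹W_{a₀})_i, 𝒪_Z) ≤ ℓ_T Ȟ¹(𝒰, 𝒪_Z) = 0` by the projective (S)-step,
and the chart lemma bounds `ℓ_{T'} Ȟ¹` of the base-changed resolution of `Spec T'` by the left-hand side.
[cite: Lipman1969, Proposition (1.2) 1), proof p. 200 with footnote (1)] [cite: GortzWedhorn2023, Cor. 21.82, Cor. 24.44]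
[cite: EGAIII1, Prop. (1.4.15)] -/
theorem hasRationalSingularity_of_chart_of_isProjectiveOverRing
    {T : Type} [CommRing T] [IsDomain T] [IsNoetherianRing T] [IsLocalRing T]
    (hdimT : ringKrullDim T ≤ 2)
    -- `Z` over `T` with `H¹(Z, 𝒪_Z) = 0`
    {Z : Scheme.{0}} (f : Z ⟶ Spec (.of T)) [IsProper f] (hZ : HasTrivialCechH1 f)
    -- the projective middle model `B` and `σ_B : Z → B` over `Spec T`
    {B : Scheme.{0}} [IsIntegral B] (gB : B ⟶ Spec (.of T)) [IsProper gB] (hgB : IsBirational gB)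
    (hproj : Literature.AlgebraicGeometry.Crystalline.IsProjectiveOverRing
      (CategoryTheory.Over.mk gB : Literature.AlgebraicGeometry.Motives.SchemeOver T))
    (σB : Z ⟶ B) (hσB : σB ≫ gB = f)
    -- affine opens covering `B`, a distinguished member, acyclic mixed pieces
    {α : Type} (W : α → B.Opens) (hW : ∀ a, IsAffineOpen (W a)) (hWcov : ⨆ a, W a = ⊤) (a₀ : α)
    (hvan : ∀ b, b ≠ a₀ → ∀ {κ : Type} (G : κ → Z.Opens), ⨆ j, G j = σB ⁻¹ᵁ (W a₀ ⊓ W b) →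
      cechZ1 f G ≤ cechB1 f G)
    -- the chart: a resolution `σ : σ_B⁻¹(W a₀) → Spec N` over `Spec T`
    {N : Type} [CommRing N] [IsDomain N] [Algebra T N]
    (σ : ((σB ⁻¹ᵁ W a₀ : Z.Opens) : Scheme.{0}) ⟶ Spec (.of N)) (hσ : IsResolution σ)
    (hσT : (σB ⁻¹ᵁ W a₀).ι ≫ f = σ ≫ Spec.map (CommRingCat.ofHom (algebraMap T N)))
    -- the localisation `T'` of `N`
    (T' : Type) [CommRing T'] [IsDomain T'] [Algebra N T'] (M : Submonoid N) [IsLocalization M T'] :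
    HasRationalSingularity T' := by
  classical
  haveI : IsNoetherianRing (CommRingCat.of T) := ‹IsNoetherianRing T›
  haveI : IsLocalRing (CommRingCat.of T) := ‹IsLocalRing T›
  haveI : IsLocallyNoetherian Z := LocallyOfFiniteType.isLocallyNoetherian f
  haveI : CompactSpace Z := QuasiCompact.compactSpace_of_compactSpace f
  haveI : IsNoetherian Z := {}
  -- fibres of `B → Spec T` have dimension `≤ 1`
  have hfib : ∀ y : Spec (.of T), topologicalKrullDim (gB.fiber y) ≤ 1 :=
    topologicalKrullDim_fiber_le_one_of_isBirational hdimT hgB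
  -- a finite affine cover `𝒰` of `Z` refining `σ_B⁻¹𝒲`
  obtain ⟨ι, _, U, r, hUaff, hUr, hUcov⟩ := exists_finite_affine_refinement Z
    (fun a => σB ⁻¹ᵁ W a) (by rw [← Scheme.Hom.preimage_iSup, hWcov]; exact Opens.map_top _)
  -- GLUE over the projective middle model: `ℓ_T Ȟ¹((U_i ∩ σ_B⁻¹W_{a₀})_i) ≤ ℓ_T Ȟ¹(𝒰)`
  have hglue : Module.length T (CechH1 f (fun i => U i ⊓ σB ⁻¹ᵁ W a₀)) ≤
      Module.length T (CechH1 f U) := by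
    refine length_cechH1_preimage_piece_le_of_isProjectiveOverRing gB hproj (hfib (closedPoint T)) σB f
      hσB W hW hWcov U r hUr hUcov a₀ fun b hb => hvan b hb _ ?_
    calc ⨆ i, U i ⊓ σB ⁻¹ᵁ W a₀ ⊓ σB ⁻¹ᵁ W b
        = ⨆ i, U i ⊓ (σB ⁻¹ᵁ W a₀ ⊓ σB ⁻¹ᵁ W b) := by simp_rw [inf_assoc]
      _ = (⨆ i, U i) ⊓ (σB ⁻¹ᵁ W a₀ ⊓ σB ⁻¹ᵁ W b) := (iSup_inf_eq _ _).symm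
      _ = σB ⁻¹ᵁ (W a₀ ⊓ W b) := by rw [hUcov, top_inf_eq, Scheme.Hom.preimage_inf]
  -- `H¹(Z, 𝒪_Z) = 0` on the finite affine cover `𝒰`
  have h0 : Module.length T (CechH1 f U) = 0 := by
    haveI := hZ ι U hUaff hUcov
    exact Module.length_eq_zero
  -- the chart
  obtain ⟨X', f', hf', hX'⟩ := exists_isResolution_length_cechH1_le_of_chart f U hUaff hUcov
    (σB ⁻¹ᵁ W a₀) (fun O hO => SeparatedAffinePreimage.isAffineOpen_inf_preimage σB gB hO (hW a₀))
    σ hσ hσT T' M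
  refine ⟨X', f', hf', fun ι' _ U' hU' hU'cov => ?_⟩
  have hle : Module.length T' (CechH1 f' U') ≤ 0 := by
    calc Module.length T' (CechH1 f' U')
        ≤ Module.length T (CechH1 f (fun i => U i ⊓ σB ⁻¹ᵁ W a₀)) := hX' ι' U' hU' hU'cov
      _ ≤ Module.length T (CechH1 f U) := hglue
      _ = 0 := h0
  exact Module.length_eq_zero_iff.mp (nonpos_iff_eq_zero.mp hle)

/-! ## Mixed pieces over the iso locus are acyclic -/

/-- **A family of opens whose union is the preimage of an affine open over which `σ_B` is an isomorphism has all its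
Čech `1`-cocycles (of `𝒪_Z`) coboundaries**: the preimage is affine (`isAffineOpen_preimage_of_isIso_morphismRestrict`)
and Čech `H¹` of the structure sheaf vanishes on any family of opens with affine union (Görtz–Wedhorn II Lemma 22.1,
`cechZ1_le_cechB1_of_isAffineOpen_of_iSup_eq`). [cite: GortzWedhorn2023, Lemma 22.1 (p. 327)] -/
theorem cechZ1_le_cechB1_of_iSup_eq_preimage_of_isIso {T : Type} [CommRing T] {Z B : Scheme.{0}}
    (f : Z ⟶ Spec (.of T)) (σB : Z ⟶ B) (V : B.Opens) (hV : IsAffineOpen V) [IsIso (σB ∣_ V)]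
    {κ : Type} (G : κ → Z.Opens) (hG : ⨆ j, G j = σB ⁻¹ᵁ V) : cechZ1 f G ≤ cechB1 f G :=
  cechZ1_le_cechB1_of_isAffineOpen_of_iSup_eq f (isAffineOpen_preimage_of_isIso_morphismRestrict σB hV) G hG

/-- The mixed-piece hypothesis of `hasRationalSingularity_of_chart_of_isProjectiveOverRing` from an open `Ω` over
which `σ_B` is an isomorphism and which contains all the overlaps `W_{a₀} ∩ W_b`, `b ≠ a₀` (`B` separated over the
affine base, so the overlaps are affine). [cite: GortzWedhorn2023, Lemma 22.1 (p. 327)] -/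
theorem mixedPieces_acyclic_of_isIso_over {T : Type} [CommRing T] {Z B : Scheme.{0}} [B.IsSeparated]
    (f : Z ⟶ Spec (.of T)) (σB : Z ⟶ B) (Ω : B.Opens) [IsIso (σB ∣_ Ω)]
    {α : Type} (W : α → B.Opens) (hW : ∀ a, IsAffineOpen (W a)) (a₀ : α)
    (hΩ : ∀ b, b ≠ a₀ → W a₀ ⊓ W b ≤ Ω) :
    ∀ b, b ≠ a₀ → ∀ {κ : Type} (G : κ → Z.Opens), ⨆ j, G j = σB ⁻¹ᵁ (W a₀ ⊓ W b) →
      cechZ1 f G ≤ cechB1 f G := by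
  intro b hb κ G hG
  haveI : IsIso (σB ∣_ (W a₀ ⊓ W b)) := isIso_morphismRestrict_of_le σB (hΩ b hb)
  exact cechZ1_le_cechB1_of_iSup_eq_preimage_of_isIso f σB (W a₀ ⊓ W b) ((hW a₀).inf (hW b)) G hG

/-! ## The packaged form at a closed point which is isolated in the fundamental locus -/

/-- **Lipman (1.2) 1), cohomological core at a point, over a PROJECTIVE model (fact-free).**  With `T`, `f : Z → Spec T`
(`H¹(Z, 𝒪_Z) = 0`), `g_B : B → Spec T` (proper birational, `B` integral, projective over `T`) and `σ_B : Z → B` over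
`T` as in `hasRationalSingularity_of_chart_of_isProjectiveOverRing`: let `w ∈ B` be a CLOSED point, `W₀ ∋ w` an
affine open, and `Ω ⊆ B` an open over which `σ_B` is an isomorphism and which contains every point of `W₀` other
than `w`.  Then for every resolution `σ : σ_B⁻¹W₀ → Spec N` of the chart compatible with the structure maps, every
localisation `T'` of `N` has a rational singularity.  (The «good cover» `{W₀} ∪ {W_b ⊆ B ∖ {w}}` of
`exists_affineCover_eq_and_disjoint` has its overlaps `W₀ ∩ W_b` inside `W₀ ∖ {w} ⊆ Ω`.)  In Lipman's proof `w` is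
the normal point of codimension two, `Ω ⊇` the complement of the (finite) fundamental locus near `w`, and
`T' = N_𝔭 = 𝒪_{W*,w}`. [cite: Lipman1969, Proposition (1.2) 1), proof p. 200 with footnote (1)]
[cite: GortzWedhorn2023, Cor. 21.82, Cor. 24.44] -/
theorem hasRationalSingularity_of_isIso_off_point_of_isProjectiveOverRing
    {T : Type} [CommRing T] [IsDomain T] [IsNoetherianRing T] [IsLocalRing T]
    (hdimT : ringKrullDim T ≤ 2)
    {Z : Scheme.{0}} (f : Z ⟶ Spec (.of T)) [IsProper f] (hZ : HasTrivialCechH1 f)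
    {B : Scheme.{0}} [IsIntegral B] (gB : B ⟶ Spec (.of T)) [IsProper gB] (hgB : IsBirational gB)
    (hproj : Literature.AlgebraicGeometry.Crystalline.IsProjectiveOverRing
      (CategoryTheory.Over.mk gB : Literature.AlgebraicGeometry.Motives.SchemeOver T))
    (σB : Z ⟶ B) (hσB : σB ≫ gB = f)
    -- the point, its affine neighbourhood, the iso locus off the point
    (w : B) (hw : IsClosed ({w} : Set B)) (W₀ : B.Opens) (hW₀ : IsAffineOpen W₀) (hwW₀ : w ∈ W₀)
    (Ω : B.Opens) [IsIso (σB ∣_ Ω)] (hΩ : ∀ x ∈ W₀, x ≠ w → x ∈ Ω)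
    -- the chart: a resolution `σ : σ_B⁻¹W₀ → Spec N` over `Spec T`
    {N : Type} [CommRing N] [IsDomain N] [Algebra T N]
    (σ : ((σB ⁻¹ᵁ W₀ : Z.Opens) : Scheme.{0}) ⟶ Spec (.of N)) (hσ : IsResolution σ)
    (hσT : (σB ⁻¹ᵁ W₀).ι ≫ f = σ ≫ Spec.map (CommRingCat.ofHom (algebraMap T N)))
    (T' : Type) [CommRing T'] [IsDomain T'] [Algebra N T'] (M : Submonoid N) [IsLocalization M T'] :
    HasRationalSingularity T' := by
  classical
  haveI : IsNoetherianRing (CommRingCat.of T) := ‹IsNoetherianRing T›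
  haveI : B.IsSeparated := ⟨by rw [← terminal.comp_from gB]; infer_instance⟩
  haveI : IsLocallyNoetherian B := LocallyOfFiniteType.isLocallyNoetherian gB
  haveI : CompactSpace B := QuasiCompact.compactSpace_of_compactSpace gB
  haveI : IsNoetherian B := {}
  -- the good cover `{W₀} ∪ {W_b ⊆ B ∖ {w}}`
  obtain ⟨α, _, a₀, W, hWa₀, hW, hWcov, hdisj⟩ := exists_affineCover_eq_and_disjoint W₀ hW₀ {w}
    (Set.finite_singleton w) (fun p hp => by rw [Set.mem_singleton_iff.mp hp]; exact hw)
    (Set.singleton_subset_iff.mpr hwW₀)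
  subst hWa₀
  -- its overlaps `W₀ ∩ W_b` lie in `Ω`
  have hΩ' : ∀ b, b ≠ a₀ → W a₀ ⊓ W b ≤ Ω := by
    intro b hb x hx
    refine hΩ x hx.1 fun hxw => ?_
    exact Set.disjoint_left.mp (hdisj b hb) (Set.mem_singleton_iff.mpr hxw) hx.2
  exact hasRationalSingularity_of_chart_of_isProjectiveOverRing hdimT f hZ gB hgB hproj σB hσB W hW hWcov a₀
    (mixedPieces_acyclic_of_isIso_over f σB Ω W hW a₀ hΩ') σ hσ hσT T' M

end Summit.ResolutionOfSingularities.ResolutionOfSingularities.Theorems.NoZeno.RationalAscent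

end
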